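import Literature.Analysis.ODE.OutgoingHorizonAmplitude
import Literature.Geometry.Lorentzian.TeukolskyRadialSchrodingerForm
import Literature.Geometry.Lorentzian.TeukolskyHorizonNormalisedLimits
import Literature.Geometry.Lorentzian.TeukolskyInfinityNormalisedLimits
import Literature.Geometry.Lorentzian.TeukolskyWronskianBoundProofs
import Literature.Geometry.Lorentzian.KerrTimeDominatedCurrent
import HarnessLib

/-!
# Sup bound of the outgoing inhomogeneous Carter mode from a two-point kernel bound of the
# normalised pair `(R_𝓗, R_𝓘)` (DRSR §9.7 "through the representation", `s = 0`, `|a| < M`)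

(namespace `Literature.Geometry.Lorentzian.Kerr`.) The bridge between the two radial vocabularies of
the tree for the INHOMOGENEOUS equation. Input, in Teixeira da Costa's `r`-variable: a pair of classical
solutions `R_𝓗`, `R_𝓘` of the scalar radial Teukolsky ODE with `λ = Λ − a²ω²`
(`Kerr.IsRadialTeukolskySolution M a 0 ω m (Λ − a²ω²)`), normalised at `𝓗⁺` resp. `𝓘⁺` as in her
Def. 2.3 (`Kerr.IsNormalisedHorizonSolution`, `Kerr.IsNormalisedInfinitySolution`), real `ω ≠ 0`
(the threshold `ω = mω₊` is allowed), and a TWO-POINT KERNEL BOUND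
`(r² + a²)^{1/2}|R_𝓗(r)| · (r′² + a²)^{1/2}|R_𝓘(r′)| ≤ K·|𝔚|` for `r₊ < r ≤ r′`, `r′ ≥ c`
(`𝔚 = Kerr.radialWronskian M a 0 R_𝓗 R_𝓘`, constant in `r`; `c` a collar radius). Output, in the
Dafermos–Rodnianski–Shlapentokh-Rothman `r*`-variable along any tortoise radius function `R`
(`Kerr.IsTortoiseRadius`): every classical solution `u` on `ℝ` of Carter's inhomogeneous equation
`u″ + (ω² − V(R x)) u = H` (`V = Kerr.sepPotential M a ω m Λ`, `H` continuous and integrable) which is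
OUTGOING — `u′ − iωu → 0` at `+∞`, `u′ + i(ω − mω₊)u → 0` at `−∞`, `|u|²` convergent at both ends
(DRSR arXiv:1402.7034 Def. 5.1.2 / §5.3 (eq:b±)) — satisfies

  `|u(x)| ≤ K · ∫ |H| dr*`   at every `x` with `R x ≥ c`

(`Kerr.outgoingMode_norm_le_of_kernelBound`); and, from a GLOBAL envelope
`(r² + a²)^{1/2}|R_𝓘| ≤ P` instead of the kernel bound, the horizon amplitude
`A_𝓗 = lim_{x→−∞}|u|²` obeys `|𝔚|²·A_𝓗 ≤ (P ∫|H|)²` (`Kerr.outgoingMode_horizonAmplitude_le_of_envelope`,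
DRSR Prop. 9.7.1). This is DRSR's §9.7 route for the collar / horizon terms, with the quantitative
content isolated in the kernel / envelope hypotheses (fed, near extremality, by the cone kernel bound of
the `KappaExplicitWaveDecay` programme with `K = CΛ^N κ^{-N}`, `c = r₊ + θ(r₊ − r₋)`, resp. by TdC
Thm 5.1 and off-cone sup bounds). The common dictionary is `Kerr.normalisedPair_tortoise_dictionary`.

Proof = the generic Green representation `Literature.Analysis.ODE.outgoing_norm_le` /
`outgoing_wronskian_sq_mul_amplitude_le` (variation of parameters + uniqueness of the outgoing solution
from `𝔚 ≠ 0`) applied to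
`u_𝓗(x) = (R(x)² + a²)^{1/2} R_𝓗(R x)`, `u_𝓘(x) = (R(x)² + a²)^{1/2} R_𝓘(R x)`, using the tree's
dictionary: both solve `y″ + (ω² − V)y = 0` on `ℝ` (`Kerr.schrodingerForm`); their `r*`-Wronskian is
`𝔚` (`Kerr.wronskian_schrodingerForm`), non-zero by real-axis mode stability
(`Costa2019.radialWronskian_ne_zero`, a THEOREM of the tree) and constant (`Costa2019.radialWronskian_eq`);
`|u_𝓗| → 1`, `|u_𝓗′| → |ω − mω₊|` at `−∞` and `|u_𝓘| → 1`, `|u_𝓘′| → |ω|` at `+∞`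
(`TeukolskyHorizon/InfinityNormalisedLimits`); the fluxes `Im(ū_𝓗 u_𝓗′) ≡ −(ω − mω₊)`,
`Im(ū_𝓘 u_𝓘′) ≡ ω` (`Costa2019.radialFlux_eq_of_normalisedHorizon/Infinity`), whence the boundary
conditions IN DERIVATIVE FORM `u_𝓗′ + i(ω − mω₊)u_𝓗 → 0`, `u_𝓘′ − iωu_𝓘 → 0` by the identity
`|z ± iσw|² = |z|² + σ²|w|² ± 2σ Im(w̄ z)`.

NOT here (gaps recorded for the consumer): EXISTENCE of a normalised pair `(R_𝓗, R_𝓘)` for given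
`(a, ω, m, Λ)` (TdC Def. 2.3 / Lemma 2.2 asserts it; the tree has no `∃ R, IsNormalisedHorizonSolution …`
yet), and any envelope of `u_𝓗, u_𝓘` (the kernel bound is a hypothesis). Everything is proved.

## References
* M. Dafermos, I. Rodnianski, Y. Shlapentokh-Rothman, arXiv:1402.7034 = Ann. of Math. 183 (2016):
  §5.2.3 (Carter's ODE), Def. 5.1.2 / §5.3 (outgoing boundary conditions), §9.7 (the horizon term
  through the representation `u = W⁻¹(u_out ∫ u_hor H + u_hor ∫ u_out H)`).
  [DafermosRodnianskiShlapentokhrothman2014]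
* R. Teixeira da Costa, CMP 378 (2020) 705–781 = arXiv:1910.02854: Def. 2.3, Prop. 2.20, Def. 5.1,
  Remark 5.1, Cor. 5.1. [Costa2019]
-/

noncomputable section

open Complex Set Filter Topology MeasureTheory
open scoped ComplexConjugate

namespace Literature.Geometry.Lorentzian.Kerr

/-! ### Two pieces of one-point algebra -/

/-- `|z + iσw|² = |z|² + σ²|w|² + 2σ·Im(w̄ z)` for real `σ`. [folklore] -/
theorem norm_add_I_mul_mul_sq (z w : ℂ) (σ : ℝ) :
    ‖z + I * σ * w‖ ^ 2 = ‖z‖ ^ 2 + σ ^ 2 * ‖w‖ ^ 2 + 2 * σ * (conj w * z).im := by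
  simp only [Complex.sq_norm, Complex.normSq_apply, Complex.add_re, Complex.add_im, Complex.mul_re,
    Complex.mul_im, Complex.I_re, Complex.I_im, Complex.ofReal_re, Complex.ofReal_im, Complex.conj_re,
    Complex.conj_im]
  ring

/-- `|z − iωw|² = |z|² + ω²|w|² − 2ω·Im(w̄ z)` for real `ω`. [folklore] -/
theorem norm_sub_I_mul_mul_sq (z w : ℂ) (ω : ℝ) :
    ‖z - I * ω * w‖ ^ 2 = ‖z‖ ^ 2 + ω ^ 2 * ‖w‖ ^ 2 - 2 * ω * (conj w * z).im := by
  simp only [Complex.sq_norm, Complex.normSq_apply, Complex.sub_re, Complex.sub_im, Complex.mul_re,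
    Complex.mul_im, Complex.I_re, Complex.I_im, Complex.ofReal_re, Complex.ofReal_im, Complex.conj_re,
    Complex.conj_im]
  ring

/-- **The flux in the `u`-variable is `Δ·Im(R̄ R′)`.** With `S = (r² + a²)^{1/2}`, `u = S R` and
`u′ = (Δ/(r² + a²))·d/dr[S R]` (the tortoise derivative of `Kerr.schrodingerForm`):
`Im(ū u′) = (Δ/(r² + a²))·S²·Im(R̄ R′) = Δ·Im(R̄ R′)` (the `S′`-term `S S′|R|²` is real).
[cite: Costa2019, Definition 5.1] -/
theorem im_conj_schrodingerForm_mul {a Δ r : ℝ} {R : ℝ → ℂ} (hA : 0 < r ^ 2 + a ^ 2)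
    (hR : DifferentiableAt ℝ R r) :
    (conj (((Real.sqrt (r ^ 2 + a ^ 2) : ℝ) : ℂ) * R r) *
        (((Δ / (r ^ 2 + a ^ 2) : ℝ) : ℂ) *
          deriv (fun s : ℝ ↦ ((Real.sqrt (s ^ 2 + a ^ 2) : ℝ) : ℂ) * R s) r)).im =
      Δ * (conj (R r) * deriv R r).im := by
  have h1 : HasDerivAt (fun s : ℝ ↦ s ^ 2 + a ^ 2) (2 * r) r := by
    simpa using (hasDerivAt_pow 2 r).add_const (a ^ 2)
  have hS : HasDerivAt (fun s : ℝ ↦ Real.sqrt (s ^ 2 + a ^ 2))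
      (2 * r / (2 * Real.sqrt (r ^ 2 + a ^ 2))) r := h1.sqrt hA.ne'
  rw [(hS.ofReal_comp.fun_mul hR.hasDerivAt).deriv]
  set S : ℝ := Real.sqrt (r ^ 2 + a ^ 2) with hSdef
  have hS2 : S ^ 2 = r ^ 2 + a ^ 2 := Real.sq_sqrt hA.le
  have h0 : (conj (R r) * R r).im = 0 := by
    rw [Complex.conj_mul', ← Complex.ofReal_pow, Complex.ofReal_im]
  have e : conj ((S : ℂ) * R r) *
      (((Δ / (r ^ 2 + a ^ 2) : ℝ) : ℂ) * (((2 * r / (2 * S) : ℝ) : ℂ) * R r + (S : ℂ) * deriv R r)) =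
      ((S * (Δ / (r ^ 2 + a ^ 2)) * (2 * r / (2 * S)) : ℝ) : ℂ) * (conj (R r) * R r) +
        ((S * (Δ / (r ^ 2 + a ^ 2)) * S : ℝ) : ℂ) * (conj (R r) * deriv R r) := by
    simp only [map_mul, Complex.conj_ofReal]
    push_cast
    ring
  have hc : S * (Δ / (r ^ 2 + a ^ 2)) * S = Δ := by
    calc S * (Δ / (r ^ 2 + a ^ 2)) * S = Δ * (S ^ 2 / (r ^ 2 + a ^ 2)) := by ring
      _ = Δ := by rw [hS2, div_self hA.ne', mul_one]
  rw [e, Complex.add_im, Complex.im_ofReal_mul, Complex.im_ofReal_mul, h0, mul_zero, zero_add, hc]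

/-! ### The normalised pair in the tortoise variable: the dictionary bundle -/

/-- **The TdC ↔ DRSR dictionary for the normalised pair** (`s = 0`, `0 < M`, `|a| < M`, `ω ≠ 0`). For
classical radial solutions `R_𝓗`, `R_𝓘` with `λ = Λ − a²ω²`, normalised at `𝓗⁺` resp. `𝓘⁺`
(TdC Def. 2.3), and a tortoise radius function `R`, the functions `u_𝓗(y) = (R(y)² + a²)^{1/2} R_𝓗(R y)`,
`u_𝓘(y) = (R(y)² + a²)^{1/2} R_𝓘(R y)` have tortoise derivatives `u_𝓗′`, `u_𝓘′` such that: both solve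
Carter's equation `y″ = −(ω² − V(R y))y` on `ℝ` (`Kerr.schrodingerForm`); the `r*`-Wronskian
`u_𝓗 u_𝓘′ − u_𝓗′ u_𝓘` is `𝔚(R y)` (`Kerr.wronskian_schrodingerForm`) and does not vanish (real-axis mode
stability, `Costa2019.radialWronskian_ne_zero`); `|u_𝓗| → 1` at `−∞`, `|u_𝓘| → 1` at `+∞`; and the
boundary conditions hold IN DERIVATIVE FORM, `u_𝓗′ + i(ω − mω₊)u_𝓗 → 0` at `−∞` and
`u_𝓘′ − iωu_𝓘 → 0` at `+∞` (from `|u_𝓗′| → |ω − mω₊|`, `|u_𝓘′| → |ω|` and the fluxes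
`Im(ū_𝓗u_𝓗′) ≡ −(ω − mω₊)`, `Im(ū_𝓘u_𝓘′) ≡ ω` by `|z ± iσw|² = |z|² + σ²|w|² ± 2σIm(w̄z)`). DRSR §5.3
(`u_hor ∼ e^{−i(ω−mω₊)r*}`, `u_out ∼ e^{iωr*}`). [cite: DafermosRodnianskiShlapentokhrothman2014, §5.3] -/
theorem normalisedPair_tortoise_dictionary {M a ω Λ : ℝ} {m : ℤ} (hM : 0 < M) (ha : |a| < M)
    (hω : ω ≠ 0) {RH RI : ℝ → ℂ}
    (hRH : IsRadialTeukolskySolution M a 0 ω m (Λ - a ^ 2 * ω ^ 2) RH)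
    (hnH : IsNormalisedHorizonSolution M a 0 ω m RH)
    (hRI : IsRadialTeukolskySolution M a 0 ω m (Λ - a ^ 2 * ω ^ 2) RI)
    (hnI : IsNormalisedInfinitySolution M 0 ω RI) {R : ℝ → ℝ} (hR : IsTortoiseRadius M a R) :
    ∃ uH₁ uI₁ : ℝ → ℂ,
      (∀ y, HasDerivAt (fun y ↦ ((Real.sqrt (R y ^ 2 + a ^ 2) : ℝ) : ℂ) * RH (R y)) (uH₁ y) y ∧
        HasDerivAt uH₁ (-(((ω ^ 2 - sepPotential M a ω m Λ (R y) : ℝ) : ℂ) * (((Real.sqrt (R y ^ 2 + a ^ 2) : ℝ) : ℂ) * RH (R y)))) y) ∧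
      (∀ y, HasDerivAt (fun y ↦ ((Real.sqrt (R y ^ 2 + a ^ 2) : ℝ) : ℂ) * RI (R y)) (uI₁ y) y ∧
        HasDerivAt uI₁ (-(((ω ^ 2 - sepPotential M a ω m Λ (R y) : ℝ) : ℂ) * (((Real.sqrt (R y ^ 2 + a ^ 2) : ℝ) : ℂ) * RI (R y)))) y) ∧
      (∀ y, ((Real.sqrt (R y ^ 2 + a ^ 2) : ℝ) : ℂ) * RH (R y) * uI₁ y - uH₁ y * (((Real.sqrt (R y ^ 2 + a ^ 2) : ℝ) : ℂ) * RI (R y)) = radialWronskian M a 0 RH RI (R y)) ∧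
      ((Real.sqrt (R 0 ^ 2 + a ^ 2) : ℝ) : ℂ) * RH (R 0) * uI₁ 0 - uH₁ 0 * (((Real.sqrt (R 0 ^ 2 + a ^ 2) : ℝ) : ℂ) * RI (R 0)) ≠ 0 ∧
      Tendsto (fun y ↦ ‖((Real.sqrt (R y ^ 2 + a ^ 2) : ℝ) : ℂ) * RH (R y)‖) atBot (𝓝 1) ∧
      Tendsto (fun y ↦ ‖((Real.sqrt (R y ^ 2 + a ^ 2) : ℝ) : ℂ) * RI (R y)‖) atTop (𝓝 1) ∧
      Tendsto (fun y ↦ uH₁ y + I * ((ω - m * horizonAngularVelocity M a : ℝ) : ℂ) * (((Real.sqrt (R y ^ 2 + a ^ 2) : ℝ) : ℂ) * RH (R y)))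
        atBot (𝓝 0) ∧
      Tendsto (fun y ↦ uI₁ y - I * ω * (((Real.sqrt (R y ^ 2 + a ^ 2) : ℝ) : ℂ) * RI (R y))) atTop (𝓝 0) := by
  have hMa : IsSubextremal M a := ha
  set σ : ℝ := ω - m * horizonAngularVelocity M a with hσdef
  obtain ⟨uH₁, uH₂, hSH⟩ := schrodingerForm hM ha hRH hR
  obtain ⟨uI₁, uI₂, hSI⟩ := schrodingerForm hM ha hRI hR
  set uH : ℝ → ℂ := fun y ↦ ((Real.sqrt (R y ^ 2 + a ^ 2) : ℝ) : ℂ) * RH (R y) with huHdef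
  set uI : ℝ → ℂ := fun y ↦ ((Real.sqrt (R y ^ 2 + a ^ 2) : ℝ) : ℂ) * RI (R y) with huIdef
  have hHpair : ∀ y, HasDerivAt uH (uH₁ y) y ∧
      HasDerivAt uH₁ (-(((ω ^ 2 - sepPotential M a ω m Λ (R y) : ℝ) : ℂ) * uH y)) y := fun y ↦ by
    obtain ⟨h1, h2, h3, -⟩ := hSH y
    exact ⟨h1, by rw [← eq_neg_of_add_eq_zero_left h3]; exact h2⟩
  have hIpair : ∀ y, HasDerivAt uI (uI₁ y) y ∧
      HasDerivAt uI₁ (-(((ω ^ 2 - sepPotential M a ω m Λ (R y) : ℝ) : ℂ) * uI y)) y := fun y ↦ by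
    obtain ⟨h1, h2, h3, -⟩ := hSI y
    exact ⟨h1, by rw [← eq_neg_of_add_eq_zero_left h3]; exact h2⟩
  -- differentiability of `R_𝓗`, `R_𝓘` at the radii `R y`
  have hdH : ∀ y, DifferentiableAt ℝ RH (R y) := fun y ↦ by
    obtain ⟨R', R'', h⟩ := hRH
    exact (h (R y) (hR.rPlus_lt y)).1.differentiableAt
  have hdI : ∀ y, DifferentiableAt ℝ RI (R y) := fun y ↦ by
    obtain ⟨R', R'', h⟩ := hRI
    exact (h (R y) (hR.rPlus_lt y)).1.differentiableAt
  -- the `r*`-Wronskian is `𝔚`, non-zero by real-axis mode stability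
  have hWR : ∀ y, uH y * uI₁ y - uH₁ y * uI y = radialWronskian M a 0 RH RI (R y) := fun y ↦ by
    obtain ⟨-, -, -, eH⟩ := hSH y
    obtain ⟨-, -, -, eI⟩ := hSI y
    rw [← wronskian_schrodingerForm ha hR (hdH y) (hdI y), eH, eI]
    simp only [huHdef, huIdef]
    ring
  have hW : uH 0 * uI₁ 0 - uH₁ 0 * uI 0 ≠ 0 := by
    rw [hWR 0]
    exact Costa2019.radialWronskian_ne_zero hM ha ⟨0, by norm_num⟩ ⟨m, by simp⟩ hω hRH hnH hRI hnI
      (R 0) (hR.rPlus_lt 0)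
  -- norms of the pair and of its tortoise derivatives
  have hnormH : ∀ y, ‖uH y‖ = Real.sqrt (R y ^ 2 + a ^ 2) * ‖RH (R y)‖ := fun y ↦ by
    simp only [huHdef, norm_mul, Complex.norm_real, Real.norm_eq_abs,
      abs_of_nonneg (Real.sqrt_nonneg _)]
  have hnormI : ∀ y, ‖uI y‖ = Real.sqrt (R y ^ 2 + a ^ 2) * ‖RI (R y)‖ := fun y ↦ by
    simp only [huIdef, norm_mul, Complex.norm_real, Real.norm_eq_abs,
      abs_of_nonneg (Real.sqrt_nonneg _)]
  have hnormH₁ : ∀ y, ‖uH₁ y‖ = delta M a (R y) / (R y ^ 2 + a ^ 2) *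
      ‖deriv (fun s : ℝ ↦ ((Real.sqrt (s ^ 2 + a ^ 2) : ℝ) : ℂ) * RH s) (R y)‖ := fun y ↦ by
    obtain ⟨-, -, -, eH⟩ := hSH y
    rw [eH, norm_mul, Complex.norm_real, Real.norm_eq_abs, abs_of_pos (hR.deriv_pos hMa y)]
  have hnormI₁ : ∀ y, ‖uI₁ y‖ = delta M a (R y) / (R y ^ 2 + a ^ 2) *
      ‖deriv (fun s : ℝ ↦ ((Real.sqrt (s ^ 2 + a ^ 2) : ℝ) : ℂ) * RI s) (R y)‖ := fun y ↦ by
    obtain ⟨-, -, -, eI⟩ := hSI y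
    rw [eI, norm_mul, Complex.norm_real, Real.norm_eq_abs, abs_of_pos (hR.deriv_pos hMa y)]
  -- the fluxes `Im(ū_𝓗 u_𝓗′) = −σ`, `Im(ū_𝓘 u_𝓘′) = ω`
  have hfluxH : ∀ y, (conj (uH y) * uH₁ y).im = -σ := fun y ↦ by
    obtain ⟨-, -, -, eH⟩ := hSH y
    rw [eH]
    simp only [huHdef]
    rw [im_conj_schrodingerForm_mul (hR.sq_add_sq_pos hMa y) (hdH y)]
    exact Costa2019.radialFlux_eq_of_normalisedHorizon ha hRH hnH (hR.rPlus_lt y)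
  have hfluxI : ∀ y, (conj (uI y) * uI₁ y).im = ω := fun y ↦ by
    obtain ⟨-, -, -, eI⟩ := hSI y
    rw [eI]
    simp only [huIdef]
    rw [im_conj_schrodingerForm_mul (hR.sq_add_sq_pos hMa y) (hdI y)]
    exact Costa2019.radialFlux_eq_of_normalisedInfinity hM ha hω hRI hnI (hR.rPlus_lt y)
  -- limits along the tortoise radius function
  have hRbot : Tendsto R atBot (𝓝[>] rPlus M a) :=
    tendsto_nhdsWithin_iff.2 ⟨hR.tendsto_atBot, Eventually.of_forall fun y ↦ hR.rPlus_lt y⟩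
  have hTH : Tendsto (fun y ↦ ‖uH y‖) atBot (𝓝 1) :=
    ((Costa2019.tendsto_norm_horizonSolution hnH).comp hRbot).congr fun y ↦ (hnormH y).symm
  have hTH₁ : Tendsto (fun y ↦ ‖uH₁ y‖) atBot (𝓝 |σ|) :=
    ((Costa2019.tendsto_norm_deriv_horizonSolution hM ha hnH).comp hRbot).congr
      fun y ↦ (hnormH₁ y).symm
  have hTI : Tendsto (fun y ↦ ‖uI y‖) atTop (𝓝 1) :=
    ((Costa2019.tendsto_norm_infinitySolution hnI).comp hR.tendsto_atTop).congr
      fun y ↦ (hnormI y).symm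
  have hTI₁ : Tendsto (fun y ↦ ‖uI₁ y‖) atTop (𝓝 |ω|) :=
    ((Costa2019.tendsto_norm_deriv_infinitySolution hM ha hω hRI hnI).comp hR.tendsto_atTop).congr
      fun y ↦ (hnormI₁ y).symm
  -- the boundary conditions of the pair in derivative form
  have hHo : Tendsto (fun y ↦ uH₁ y + I * (σ : ℂ) * uH y) atBot (𝓝 0) := by
    have h2 : Tendsto (fun y ↦ ‖uH₁ y + I * (σ : ℂ) * uH y‖ ^ 2) atBot (𝓝 0) := by
      have h := ((hTH₁.pow 2).add ((hTH.pow 2).const_mul (σ ^ 2))).add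
        (tendsto_const_nhds (x := 2 * σ * (-σ)))
      have e : |σ| ^ 2 + σ ^ 2 * 1 ^ 2 + 2 * σ * (-σ) = 0 := by rw [sq_abs]; ring
      rw [e] at h
      refine h.congr fun y ↦ ?_
      rw [norm_add_I_mul_mul_sq, hfluxH y]
    rw [tendsto_zero_iff_norm_tendsto_zero]
    have h3 := h2.sqrt
    rw [Real.sqrt_zero] at h3
    exact h3.congr fun y ↦ Real.sqrt_sq (norm_nonneg _)
  have hIo : Tendsto (fun y ↦ uI₁ y - I * (ω : ℂ) * uI y) atTop (𝓝 0) := by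
    have h2 : Tendsto (fun y ↦ ‖uI₁ y - I * (ω : ℂ) * uI y‖ ^ 2) atTop (𝓝 0) := by
      have h := ((hTI₁.pow 2).add ((hTI.pow 2).const_mul (ω ^ 2))).sub
        (tendsto_const_nhds (x := 2 * ω * ω))
      have e : |ω| ^ 2 + ω ^ 2 * 1 ^ 2 - 2 * ω * ω = 0 := by rw [sq_abs]; ring
      rw [e] at h
      refine h.congr fun y ↦ ?_
      rw [norm_sub_I_mul_mul_sq, hfluxI y]
    rw [tendsto_zero_iff_norm_tendsto_zero]
    have h3 := h2.sqrt
    rw [Real.sqrt_zero] at h3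
    exact h3.congr fun y ↦ Real.sqrt_sq (norm_nonneg _)
  exact ⟨uH₁, uI₁, hHpair, hIpair, hWR, hW, hTH, hTI, hHo, hIo⟩

/-! ### The sup bound of the outgoing solution -/

/-- **Sup bound of the outgoing inhomogeneous Carter mode from a two-point kernel bound** (DRSR
§9.7 "through the representation formula", `s = 0`). Let `0 < M`, `|a| < M`, `ω ≠ 0` (no
hypothesis `ω ≠ mω₊` is needed); let `R_𝓗`, `R_𝓘` be classical solutions of the scalar radial
Teukolsky ODE with `λ = Λ − a²ω²`, normalised at `𝓗⁺` resp. `𝓘⁺` (TdC Def. 2.3), satisfying the kernel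
bound `(r² + a²)^{1/2}|R_𝓗(r)|·(r′² + a²)^{1/2}|R_𝓘(r′)| ≤ K|𝔚(r)|` for all `r₊ < r ≤ r′` with
`c ≤ r′`. Let `R` be a tortoise radius function and `u` a classical solution on `ℝ` of
`u″ + (ω² − V(R x))u = H` (`V = Kerr.sepPotential M a ω m Λ`, `H` continuous, integrable) which is
outgoing: `u′ − iωu → 0` at `+∞`, `u′ + i(ω − mω₊)u → 0` at `−∞`, `|u|² → A_±` at `±∞`. Then
`|u(x)| ≤ K ∫ |H|` at every `x` with `c ≤ R x`. Content: `u = 𝔚⁻¹(u_𝓘 ∫_{−∞}^x u_𝓗 H + u_𝓗 ∫_x^∞ u_𝓘 H)`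
(`Literature.Analysis.ODE.outgoing_norm_le` on the dictionary bundle) and the kernel bound on
`y ≤ x`, `x ≤ y`. [cite: DafermosRodnianskiShlapentokhrothman2014, §9.7] -/
theorem outgoingMode_norm_le_of_kernelBound {M a ω Λ c K : ℝ} {m : ℤ} (hM : 0 < M) (ha : |a| < M)
    (hω : ω ≠ 0) {RH RI : ℝ → ℂ}
    (hRH : IsRadialTeukolskySolution M a 0 ω m (Λ - a ^ 2 * ω ^ 2) RH)
    (hnH : IsNormalisedHorizonSolution M a 0 ω m RH)
    (hRI : IsRadialTeukolskySolution M a 0 ω m (Λ - a ^ 2 * ω ^ 2) RI)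
    (hnI : IsNormalisedInfinitySolution M 0 ω RI)
    (hK : ∀ r r' : ℝ, rPlus M a < r → r ≤ r' → c ≤ r' →
      Real.sqrt (r ^ 2 + a ^ 2) * ‖RH r‖ * (Real.sqrt (r' ^ 2 + a ^ 2) * ‖RI r'‖) ≤
        K * ‖radialWronskian M a 0 RH RI r‖)
    {R : ℝ → ℝ} (hR : IsTortoiseRadius M a R) {u u₁ u₂ H : ℝ → ℂ} {Atop Abot : ℝ}
    (hu : ∀ x, HasDerivAt u (u₁ x) x) (hu₁ : ∀ x, HasDerivAt u₁ (u₂ x) x)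
    (hode : ∀ x, u₂ x + ((ω ^ 2 - sepPotential M a ω m Λ (R x) : ℝ) : ℂ) * u x = H x)
    (hHc : Continuous H) (hHi : Integrable H)
    (hout : Tendsto (fun x ↦ u₁ x - I * ω * u x) atTop (𝓝 0))
    (hin : Tendsto (fun x ↦ u₁ x + I * ((ω - m * horizonAngularVelocity M a : ℝ) : ℂ) * u x)
      atBot (𝓝 0))
    (hAtop : Tendsto (fun x ↦ ‖u x‖ ^ 2) atTop (𝓝 Atop))
    (hAbot : Tendsto (fun x ↦ ‖u x‖ ^ 2) atBot (𝓝 Abot)) {x : ℝ} (hx : c ≤ R x) :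
    ‖u x‖ ≤ K * ∫ y, ‖H y‖ := by
  have hMa : IsSubextremal M a := ha
  obtain ⟨uH₁, uI₁, hHpair, hIpair, hWR, hW, hTH, hTI, hHo, hIo⟩ :=
    normalisedPair_tortoise_dictionary (Λ := Λ) hM ha hω hRH hnH hRI hnI hR
  have hnormH : ∀ y, ‖((Real.sqrt (R y ^ 2 + a ^ 2) : ℝ) : ℂ) * RH (R y)‖ = Real.sqrt (R y ^ 2 + a ^ 2) * ‖RH (R y)‖ := fun y ↦ by
    rw [norm_mul, Complex.norm_real, Real.norm_eq_abs, abs_of_nonneg (Real.sqrt_nonneg _)]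
  have hnormI : ∀ y, ‖((Real.sqrt (R y ^ 2 + a ^ 2) : ℝ) : ℂ) * RI (R y)‖ = Real.sqrt (R y ^ 2 + a ^ 2) * ‖RI (R y)‖ := fun y ↦ by
    rw [norm_mul, Complex.norm_real, Real.norm_eq_abs, abs_of_nonneg (Real.sqrt_nonneg _)]
  have hWconst : ∀ y, radialWronskian M a 0 RH RI (R y) = radialWronskian M a 0 RH RI (R 0) :=
    fun y ↦ Costa2019.radialWronskian_eq ha.le hRH hRI (hR.rPlus_lt y) (hR.rPlus_lt 0)
  -- the kernel bound in the tortoise variable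
  have hK' : ∀ y z, y ≤ z → c ≤ R z → ‖((Real.sqrt (R y ^ 2 + a ^ 2) : ℝ) : ℂ) * RH (R y)‖ * ‖((Real.sqrt (R z ^ 2 + a ^ 2) : ℝ) : ℂ) * RI (R z)‖ ≤
      K * ‖((Real.sqrt (R 0 ^ 2 + a ^ 2) : ℝ) : ℂ) * RH (R 0) * uI₁ 0 - uH₁ 0 * (((Real.sqrt (R 0 ^ 2 + a ^ 2) : ℝ) : ℂ) * RI (R 0))‖ := by
    intro y z hyz hz
    rw [hWR 0, ← hWconst y, hnormH y, hnormI z]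
    exact hK (R y) (R z) (hR.rPlus_lt y) ((hR.strictMono hMa).monotone hyz) hz
  exact Literature.Analysis.ODE.outgoing_norm_le
    (φ := fun y ↦ ω ^ 2 - sepPotential M a ω m Λ (R y)) (p := fun y ↦ c ≤ R y)
    hHpair hIpair hW hTH.isBoundedUnder_le hTI.isBoundedUnder_le hHo hIo hu hu₁ hode hHc hHi
    (isBoundedUnder_norm_of_tendsto_norm_sq hAbot) (isBoundedUnder_norm_of_tendsto_norm_sq hAtop)
    hin hout (fun y z hy hyz ↦ hy.trans ((hR.strictMono hMa).monotone hyz)) hK' hx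

/-! ### The horizon amplitude of the outgoing solution -/

/-- **The horizon amplitude of the outgoing inhomogeneous Carter mode from a global envelope of
`u_𝓘`** (DRSR Prop. 9.7.1 "through the representation", `s = 0`): in the setting of
`outgoingMode_norm_le_of_kernelBound`, if instead of the kernel bound a GLOBAL envelope
`(r² + a²)^{1/2}|R_𝓘(r)| ≤ P` on `(r₊, ∞)` is known, then the horizon amplitude
`A_𝓗 = lim_{x→−∞}|u(x)|²` satisfies `|𝔚(r)|²·A_𝓗 ≤ (P ∫|H|)²` at every `r > r₊`
(`|𝔚|²A_𝓗 = |∫_ℝ u_𝓘 H|²`, `Literature.Analysis.ODE.outgoing_wronskian_sq_mul_amplitude_le` with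
`ℓ = lim|u_𝓗| = 1`). With quantitative mode stability `|𝔚|⁻² ≤ G` (TdC Thm 5.1) this is the
horizon-term bound `A_𝓗 ≤ G P² (∫|H|)²`. [cite: DafermosRodnianskiShlapentokhrothman2014, Prop. 9.7.1] -/
theorem outgoingMode_horizonAmplitude_le_of_envelope {M a ω Λ P : ℝ} {m : ℤ} (hM : 0 < M)
    (ha : |a| < M) (hω : ω ≠ 0) {RH RI : ℝ → ℂ}
    (hRH : IsRadialTeukolskySolution M a 0 ω m (Λ - a ^ 2 * ω ^ 2) RH)
    (hnH : IsNormalisedHorizonSolution M a 0 ω m RH)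
    (hRI : IsRadialTeukolskySolution M a 0 ω m (Λ - a ^ 2 * ω ^ 2) RI)
    (hnI : IsNormalisedInfinitySolution M 0 ω RI)
    (hP : ∀ r : ℝ, rPlus M a < r → Real.sqrt (r ^ 2 + a ^ 2) * ‖RI r‖ ≤ P)
    {R : ℝ → ℝ} (hR : IsTortoiseRadius M a R) {u u₁ u₂ H : ℝ → ℂ} {Atop Abot : ℝ}
    (hu : ∀ x, HasDerivAt u (u₁ x) x) (hu₁ : ∀ x, HasDerivAt u₁ (u₂ x) x)
    (hode : ∀ x, u₂ x + ((ω ^ 2 - sepPotential M a ω m Λ (R x) : ℝ) : ℂ) * u x = H x)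
    (hHc : Continuous H) (hHi : Integrable H)
    (hout : Tendsto (fun x ↦ u₁ x - I * ω * u x) atTop (𝓝 0))
    (hin : Tendsto (fun x ↦ u₁ x + I * ((ω - m * horizonAngularVelocity M a : ℝ) : ℂ) * u x)
      atBot (𝓝 0))
    (hAtop : Tendsto (fun x ↦ ‖u x‖ ^ 2) atTop (𝓝 Atop))
    (hAbot : Tendsto (fun x ↦ ‖u x‖ ^ 2) atBot (𝓝 Abot)) {r : ℝ} (hr : rPlus M a < r) :
    ‖radialWronskian M a 0 RH RI r‖ ^ 2 * Abot ≤ (P * ∫ y, ‖H y‖) ^ 2 := by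
  have hMa : IsSubextremal M a := ha
  obtain ⟨uH₁, uI₁, hHpair, hIpair, hWR, hW, hTH, hTI, hHo, hIo⟩ :=
    normalisedPair_tortoise_dictionary (Λ := Λ) hM ha hω hRH hnH hRI hnI hR
  have hnormI : ∀ y, ‖((Real.sqrt (R y ^ 2 + a ^ 2) : ℝ) : ℂ) * RI (R y)‖ = Real.sqrt (R y ^ 2 + a ^ 2) * ‖RI (R y)‖ := fun y ↦ by
    rw [norm_mul, Complex.norm_real, Real.norm_eq_abs, abs_of_nonneg (Real.sqrt_nonneg _)]
  have hP' : ∀ y, ‖((Real.sqrt (R y ^ 2 + a ^ 2) : ℝ) : ℂ) * RI (R y)‖ ≤ P := fun y ↦ by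
    rw [hnormI y]; exact hP (R y) (hR.rPlus_lt y)
  have hWr : radialWronskian M a 0 RH RI r = radialWronskian M a 0 RH RI (R 0) :=
    Costa2019.radialWronskian_eq ha.le hRH hRI hr (hR.rPlus_lt 0)
  have h := Literature.Analysis.ODE.outgoing_wronskian_sq_mul_amplitude_le
    (φ := fun y ↦ ω ^ 2 - sepPotential M a ω m Λ (R y))
    hHpair hIpair hW hTH.isBoundedUnder_le hTI.isBoundedUnder_le hHo hIo hu hu₁ hode hHc hHi
    (isBoundedUnder_norm_of_tendsto_norm_sq hAbot) (isBoundedUnder_norm_of_tendsto_norm_sq hAtop)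
    hin hout hP' hTH hAbot
  rw [hWR 0, one_pow, one_mul] at h
  rwa [hWr]

end Literature.Geometry.Lorentzian.Kerr

end
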